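import Literature.Analysis.PDE.ABPEstimate
import Mathlib.Analysis.SpecialFunctions.Pow.Real
import HarnessLib

/-!
# The ABP estimate for uniformly elliptic coefficients (Gilbarg–Trudinger Lemma 9.3, `b = c = 0`)

From the measure form of the Aleksandrov–Bakelman–Pucci estimate
(`addHaar_ball_le_lintegral_abp`) we derive the form consumed by the Krylov–Safonov argument
(GT (9.54)): for coefficients `a(y)` symmetric with `λ|ξ|² ≤ a^{ij}ξ_iξ_j`, `λ > 0`, and a
measurable majorant `F ≥ -a^{ij}D_{ij}u`, `F ≥ 0`,

* `det_ge_pow_of_elliptic` — `det a ≥ λⁿ`;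
* `trace_mul_nonneg_of_posSemidef` — `tr(aB) ≥ 0` for `a, B ≥ 0` (so `-a^{ij}D_{ij}u ≥ 0` on `Γ⁺`);
* `addHaar_ball_le_lintegral_elliptic` — `μ(B_{M/d}) ≤ ∫_Ω (F/(nλ))ⁿ`;
* `sup_le_diam_mul_rpow` — the classical bound `u(x₀) ≤ d · (ω⁻¹ ∫_Ω (F/(nλ))ⁿ)^{1/n}`,
  `ω = μ(B₁)`, when the integral is finite.

## References

* D. Gilbarg, N. S. Trudinger, *Elliptic Partial Differential Equations of Second Order* (2001),
  Lemma 9.3 / Theorem 9.1. [GilbargTrudinger2001]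
-/

noncomputable section

open Set Metric MeasureTheory Matrix Finset
open scoped ENNReal MatrixOrder

namespace Literature.Analysis.PDE.ABP

variable {ι : Type*} [Fintype ι] [DecidableEq ι]

/-! ### Matrix facts -/

/-- **Uniform ellipticity bounds the determinant below**: if `a` is symmetric and
`λ (v·v) ≤ v·(a v)` for all `v`, then `λⁿ ≤ det a` (each eigenvalue is a Rayleigh quotient `≥ λ`).
[folklore] -/
theorem det_ge_pow_of_elliptic {a : Matrix ι ι ℝ} (ha : a.IsHermitian) {lam : ℝ} (hlam : 0 ≤ lam)
    (hell : ∀ v : ι → ℝ, lam * (v ⬝ᵥ v) ≤ v ⬝ᵥ (a *ᵥ v)) :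
    lam ^ Fintype.card ι ≤ a.det := by
  have hdet : a.det = ∏ i, ha.eigenvalues i := by
    rw [ha.det_eq_prod_eigenvalues]; simp
  have heig : ∀ i, lam ≤ ha.eigenvalues i := fun i ↦ by
    set v := (ha.eigenvectorBasis i).ofLp with hv
    have h1 : ha.eigenvalues i = v ⬝ᵥ (a *ᵥ v) := by
      rw [ha.eigenvalues_eq i]; simp [hv]
    have hvv : v ⬝ᵥ v = 1 := by
      have hn : ‖ha.eigenvectorBasis i‖ = 1 := ha.eigenvectorBasis.orthonormal.1 i
      have h2 : ‖ha.eigenvectorBasis i‖ ^ 2 = v ⬝ᵥ v := by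
        rw [EuclideanSpace.norm_eq, Real.sq_sqrt (Finset.sum_nonneg fun j _ ↦ sq_nonneg _)]
        simp [dotProduct, hv, pow_two]
      rw [← h2, hn, one_pow]
    have := hell v
    rw [hvv, mul_one, ← h1] at this
    exact this
  rw [hdet, ← Finset.card_univ, ← Finset.prod_const]
  exact Finset.prod_le_prod (fun i _ ↦ hlam) fun i _ ↦ heig i

/-- **`tr(aB) ≥ 0` for positive semidefinite `a`, `B`** (`tr(aB) = tr(a^{1/2} B a^{1/2}) ≥ 0`).
[folklore] -/
theorem trace_mul_nonneg_of_posSemidef {a B : Matrix ι ι ℝ} (ha : a.PosSemidef)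
    (hB : B.PosSemidef) : 0 ≤ (a * B).trace := by
  have ha0 : 0 ≤ a := ha.nonneg
  set S : Matrix ι ι ℝ := CFC.sqrt a with hS
  have hSpsd : S.PosSemidef := (CFC.sqrt_nonneg a).posSemidef
  have hSS : S * S = a := CFC.sqrt_mul_sqrt_self a
  have hSH : Sᴴ = S := hSpsd.1
  have hM : (S * B * Sᴴ).PosSemidef := hB.mul_mul_conjTranspose_same S
  have htrM : (S * B * Sᴴ).trace = (a * B).trace := by
    rw [hSH, Matrix.mul_assoc, trace_mul_comm, Matrix.mul_assoc, hSS, trace_mul_comm]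
  rw [← htrM]
  exact hM.trace_nonneg

omit [DecidableEq ι] in
/-- Ellipticity with `λ > 0` and symmetry give positive definiteness. [folklore] -/
theorem posDef_of_elliptic {a : Matrix ι ι ℝ} (ha : a.IsHermitian) {lam : ℝ} (hlam : 0 < lam)
    (hell : ∀ v : ι → ℝ, lam * (v ⬝ᵥ v) ≤ v ⬝ᵥ (a *ᵥ v)) : a.PosDef := by
  rw [posDef_iff_dotProduct_mulVec]
  refine ⟨ha, fun x hx ↦ ?_⟩
  have hxx : 0 < x ⬝ᵥ x := by
    rw [dotProduct]
    obtain ⟨i, hi⟩ : ∃ i, x i ≠ 0 := by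
      by_contra h; push Not at h; exact hx (funext h)
    exact Finset.sum_pos' (fun j _ ↦ mul_self_nonneg _) ⟨i, Finset.mem_univ _, mul_self_pos.2 hi⟩
  have := hell x
  simp only [star_trivial]
  nlinarith

/-! ### The elliptic ABP bound -/

variable {E : Type*} [NormedAddCommGroup E] [InnerProductSpace ℝ E] [FiniteDimensional ℝ E]
  [MeasurableSpace E] [BorelSpace E]

/-- **ABP for uniformly elliptic coefficients, measure form**: with `u ≤ 0` on `∂Ω`, `a` symmetric,
`λ|ξ|² ≤ a ξ·ξ` (`λ > 0`) and `-a^{ij}D_{ij}u ≤ F`, `F ≥ 0` on `Ω`: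
`μ(B(0, u(x₀)/d)) ≤ ∫_Ω (F/(nλ))ⁿ dμ`. [cite: GilbargTrudinger2001, Lemma 9.3 (b = c = 0)] -/
theorem addHaar_ball_le_lintegral_elliptic [Nonempty ι] (μ : Measure E) [μ.IsAddHaarMeasure]
    {Ω : Set E} (hΩo : IsOpen Ω) (hΩb : Bornology.IsBounded Ω) {u : E → ℝ}
    (hu : ContinuousOn u (closure Ω)) (hdiff : ∀ y ∈ Ω, DifferentiableAt ℝ u y)
    (hgu : ContinuousOn (gradient u) Ω) (hD2f : ∀ y ∈ Ω, DifferentiableAt ℝ (fderiv ℝ u) y)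
    (hsymm : ∀ y ∈ Ω, ∀ v w, fderiv ℝ (fderiv ℝ u) y v w = fderiv ℝ (fderiv ℝ u) y w v)
    (hbd : ∀ y ∈ frontier Ω, u y ≤ 0) {x₀ : E} (hx₀ : x₀ ∈ Ω) (hd : 0 < diam (closure Ω))
    (b : OrthonormalBasis ι ℝ E) {a : E → Matrix ι ι ℝ} (haH : ∀ y ∈ Ω, (a y).IsHermitian)
    {lam : ℝ} (hlam : 0 < lam) (hell : ∀ y ∈ Ω, ∀ v : ι → ℝ, lam * (v ⬝ᵥ v) ≤ v ⬝ᵥ (a y *ᵥ v))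
    {F : E → ℝ} (hF : ∀ y ∈ Ω, -∑ i, ∑ j, a y i j * hessianMatrix u b y i j ≤ F y) :
    μ (ball (0 : E) (u x₀ / diam (closure Ω))) ≤
      ∫⁻ y in Ω, ENNReal.ofReal ((F y / (Fintype.card ι * lam)) ^ Fintype.card ι) ∂μ := by
  haveI : CompleteSpace E := FiniteDimensional.complete ℝ E
  have ha : ∀ y ∈ Ω, (a y).PosDef := fun y hy ↦ posDef_of_elliptic (haH y hy) hlam (hell y hy)
  have h := addHaar_ball_le_lintegral_abp μ hΩo hΩb hu hdiff hgu hD2f hsymm hbd hx₀ hd b ha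
  refine h.trans ((setLIntegral_mono' (measurableSet_upperContactSet hΩo
    (hu.mono subset_closure) hgu) fun y hy ↦ ?_).trans
    (lintegral_mono_set (upperContactSet_subset u Ω)))
  have hyΩ : y ∈ Ω := hy.1
  refine ENNReal.ofReal_le_ofReal ?_
  -- sign of `-a^{ij}H_{ij}` on the contact set
  have hneg := posSemidef_neg_hessianMatrix hΩo hdiff hy (hD2f y hyΩ) (hsymm y hyΩ) b
  have hHs : ∀ i j, hessianMatrix u b y i j = hessianMatrix u b y j i := fun i j ↦ by
    simp [hsymm y hyΩ]
  have htr : (a y * -hessianMatrix u b y).trace = -∑ i, ∑ j, a y i j * hessianMatrix u b y i j :=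
    trace_mul_neg_eq _ _ hHs
  have hnn : 0 ≤ -∑ i, ∑ j, a y i j * hessianMatrix u b y i j := by
    rw [← htr]; exact trace_mul_nonneg_of_posSemidef (ha y hyΩ).posSemidef hneg
  set n := Fintype.card ι
  have hn : (0 : ℝ) < n := by exact_mod_cast Fintype.card_pos
  have hdet : lam ^ n ≤ (a y).det := det_ge_pow_of_elliptic (haH y hyΩ) hlam.le (hell y hyΩ)
  have hlampow : 0 < lam ^ n := pow_pos hlam n
  -- `((−aH)/n)ⁿ / det a ≤ ((F)/n)ⁿ / λⁿ = (F/(nλ))ⁿ`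
  have hnum : ((-∑ i, ∑ j, a y i j * hessianMatrix u b y i j) / n) ^ n ≤ (F y / n) ^ n :=
    pow_le_pow_left₀ (div_nonneg hnn hn.le) (div_le_div_of_nonneg_right (hF y hyΩ) hn.le) n
  calc ((-∑ i, ∑ j, a y i j * hessianMatrix u b y i j) / n) ^ n / (a y).det
      ≤ (F y / n) ^ n / lam ^ n :=
        div_le_div₀ (pow_nonneg (div_nonneg (hnn.trans (hF y hyΩ)) hn.le) n) hnum hlampow hdet
    _ = (F y / (n * lam)) ^ n := by rw [← div_pow, div_div]

/-- **ABP, classical form**: under the same hypotheses, if `I = ∫_Ω (F/(nλ))ⁿ dμ < ∞` then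
`u(x₀) ≤ d · (I / μ(B₁))^{1/n}`. [cite: GilbargTrudinger2001, Lemma 9.3 / (9.11) with b = c = 0] -/
theorem le_diam_mul_rpow [Nonempty ι] [Nontrivial E] (μ : Measure E) [μ.IsAddHaarMeasure]
    {Ω : Set E} (hΩo : IsOpen Ω) (hΩb : Bornology.IsBounded Ω) {u : E → ℝ}
    (hu : ContinuousOn u (closure Ω)) (hdiff : ∀ y ∈ Ω, DifferentiableAt ℝ u y)
    (hgu : ContinuousOn (gradient u) Ω) (hD2f : ∀ y ∈ Ω, DifferentiableAt ℝ (fderiv ℝ u) y)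
    (hsymm : ∀ y ∈ Ω, ∀ v w, fderiv ℝ (fderiv ℝ u) y v w = fderiv ℝ (fderiv ℝ u) y w v)
    (hbd : ∀ y ∈ frontier Ω, u y ≤ 0) {x₀ : E} (hx₀ : x₀ ∈ Ω) (hd : 0 < diam (closure Ω))
    (b : OrthonormalBasis ι ℝ E) {a : E → Matrix ι ι ℝ} (haH : ∀ y ∈ Ω, (a y).IsHermitian)
    {lam : ℝ} (hlam : 0 < lam) (hell : ∀ y ∈ Ω, ∀ v : ι → ℝ, lam * (v ⬝ᵥ v) ≤ v ⬝ᵥ (a y *ᵥ v))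
    {F : E → ℝ} (hF : ∀ y ∈ Ω, -∑ i, ∑ j, a y i j * hessianMatrix u b y i j ≤ F y)
    (hI : ∫⁻ y in Ω, ENNReal.ofReal ((F y / (Fintype.card ι * lam)) ^ Fintype.card ι) ∂μ ≠ ∞) :
    u x₀ ≤ diam (closure Ω) *
      ((∫⁻ y in Ω, ENNReal.ofReal ((F y / (Fintype.card ι * lam)) ^ Fintype.card ι) ∂μ).toReal /
        (μ (ball (0 : E) 1)).toReal) ^ (Fintype.card ι : ℝ)⁻¹ := by
  set n := Fintype.card ι with hn
  set d := diam (closure Ω)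
  set I := ∫⁻ y in Ω, ENNReal.ofReal ((F y / (n * lam)) ^ n) ∂μ
  have hω0 : μ (ball (0 : E) 1) ≠ 0 := (measure_ball_pos μ 0 one_pos).ne'
  have hωt : μ (ball (0 : E) 1) ≠ ∞ := measure_ball_lt_top.ne
  have hωpos : 0 < (μ (ball (0 : E) 1)).toReal := ENNReal.toReal_pos hω0 hωt
  have hRHS : 0 ≤ d * (I.toReal / (μ (ball (0 : E) 1)).toReal) ^ (n : ℝ)⁻¹ :=
    mul_nonneg hd.le (Real.rpow_nonneg (div_nonneg ENNReal.toReal_nonneg hωpos.le) _)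
  by_cases hM : u x₀ ≤ 0
  · exact hM.trans hRHS
  push Not at hM
  have hfin : Module.finrank ℝ E = n := by rw [hn, Module.finrank_eq_card_basis b.toBasis]
  have h := addHaar_ball_le_lintegral_elliptic μ hΩo hΩb hu hdiff hgu hD2f hsymm hbd hx₀ hd b haH
    hlam hell hF
  rw [Measure.addHaar_ball μ 0 (div_nonneg hM.le hd.le), hfin] at h
  -- pass to reals
  have hr : (u x₀ / d) ^ n * (μ (ball (0 : E) 1)).toReal ≤ I.toReal := by
    have := ENNReal.toReal_mono hI h
    rwa [ENNReal.toReal_mul, ENNReal.toReal_ofReal (pow_nonneg (div_nonneg hM.le hd.le) n)] at this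
  have hr' : (u x₀ / d) ^ n ≤ I.toReal / (μ (ball (0 : E) 1)).toReal := by
    rwa [le_div_iff₀ hωpos]
  have hn0 : n ≠ 0 := Fintype.card_ne_zero
  have hroot : u x₀ / d ≤ (I.toReal / (μ (ball (0 : E) 1)).toReal) ^ (n : ℝ)⁻¹ := by
    have := Real.rpow_le_rpow (pow_nonneg (div_nonneg hM.le hd.le) n) hr' (inv_nonneg.2 n.cast_nonneg)
    rwa [Real.pow_rpow_inv_natCast (div_nonneg hM.le hd.le) hn0] at this
  rwa [div_le_iff₀ hd, mul_comm] at hroot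

end Literature.Analysis.PDE.ABP

end
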